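import Mathlib
import HarnessLib
import Summits.HubbardSuperconductivity.HubbardSuperconductivity.Theorems.KLProgrammeKLRegimeEngineTowerChernoff

/-!
# Route `KLProgramme` — crux K3 ENGINE (stmt-HubbardSuperconductivity-20437), stub (e) proof-input «(e)-D-ROWS», (M4): THE NEAR COVARIANCE SOURCE
# OF THE TWO-VOLUME LIPSCHITZ TOWER IN E1'S KIT UNITS — closed form and the `hsrc` law row of T3-Lip₄ (seat hubbard-kl-k3c4-p1 g22; `--supports` 20437)

The two-volume (Lipschitz) tower of k3c5-p2's «(e)-C-RATE» chain closes by E1's `EngineV8.towerBornDiff_le_law₄` (T3-Lip₄, `…EngineTowerLipschitz`),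
whose per-block SOURCE row is `hsrc : src k p ≤ s k · (A λ^{p−1} Q^p)` (`3 ≤ p ≤ D`) with an additive budget `R k + s k ≤ R (k+1)` — the only
place the volume enters.  The NEAR half of the covariance source (DROWS-SCOPE-g21 §3 (M4)) is the increment `effAction D_n W₁ − W₁` of the block's
(one-volume, law-unit) data `W₁` at the near DEFECT covariance `D_n` (fine block covariance minus the decoupled copies of the coarse one, off the seam
zone): its entries (`σₑ` in units) and weighted rows (`Φₙ`) are `O(2^{J}/L₁)`-small, its Gram constant is not.  At the Grassmann level this increment
has EXACTLY the shape of (b)'s own block step: orders `n ≥ 2` by the weighted graded door at `C := D_n` (prefactor `Φₙ^{n−1}`), first order by the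
entry-cost door `Literature/…/GrassmannGaussConvEntryGram` (ONE contraction at the entry sup, the rest Gram–binomial:
`(p+1)(2p+1)·σₑ·[μ(p+1) + towerFO D σₙ μ (p+1)]` in units).  This file is the real-number reading of that right side in E1's kit language:

* **`srcStep_le_of_chernoff`** (§1) — E1's (T2-gen) `towerStep_le_of_chernoff` with the first-order slot replaced by an arbitrary real `FO`:
  `src ≤ FO + Σ_{n∈[2,N]} e Φ^{n−1} ψ^p towerS_n(p) + tail` (∀ N ≥ 2) and the Chernoff data `G`, `V̄` give `src ≤ FO + e ψ^p (w^{p−1})⁻¹ G · ΦG/(1−ΦG)`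
  (by substitution into T2-gen; no new analysis);
* `srcStep_le_fourPiece` (§2) — the same read on E1's FOUR-PIECE majorant profile (`μ 1 ≤ ι₁λ`, `μ 2 ≤ ι₂λ`, `μ 3 ≤ ι₃λ²`, `μ m ≤ A'λ^{m−1}Q'^m` for
  `m ≥ 4`) at `w = (2τQ'λ)⁻¹`: `src ≤ FO + λ^{p−1}·e ψτY (2τψQ')^{p−1}·y/(1−y)`, `Y = ι₁λ + ι₂/(2Q') + ι₃/(4Q'²) + A'Q'/4`, `y = ΦτY`;
* `two_mul_four_pow_ge` (`(p+1)(2p+1) ≤ 2·4^p`) and **`foSrc_le`** (§3) — the entry-cost first order in closed form: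
  `(p+1)(2p+1)·σₑ·[μ(p+1) + towerFO D σₙ μ (p+1)] ≤ 8σₑA'λQ'/(1−x₁) · λ^{p−1}(16Q')^p` (`x₁ = 4σₙλQ' < 1`, `3 ≤ p ≤ D`, profile up to `D+1`);
* **`src_le_law`** (§4) — THE `hsrc` ROW: under `16Q' ≤ Q`, `2τψQ' ≤ Q` (E1's `hu₂`) the near source obeys
  `src ≤ s · (A λ^{p−1} Q^p)` with **`s = (8σₑA'λQ'/(1−x₁) + eψτY·y/(1−y)/Q)/A`** — linear in the two small numbers `σₑ` (entry) and `y ∝ Φₙ` (rows) of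
  the defect covariance, uniformly in `p` and `D`; summed over the `≈ n_β/d` blocks it is the `1/L₁` RATE of the rows `hdualSp`/`hdualCut`.

NOT here: the model dictionary (`σₑ, σₙ, Φₙ, ψ, τ` from the block-defect files `…TwoVolumeBlockDefect(Gram)(Bounded)` and E1's `…TowerBlockIncrWtKitDict`), the
FAR half of the covariance source (zone doors at deep pins), the transfer (re-sectorisation) source and the frame-response source — separate files of the
(M4) list.  Pure real analysis; nothing about the model is asserted; nothing asserts the (D) rows, stub (e), VL, K3 or superconductivity.
References: Benfatto–Giuliani–Mastropietro 2006 §2.8 (2.83), (2.86)–(2.90), §3 (3.2)–(3.8) [cite: BenfattoGiulianiMastropietro2006]; Gawȩdzki–Kupiainen 1985 §3.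
-/

noncomputable section

namespace Summit.HubbardSuperconductivity.HubbardSuperconductivity.Theorems.TwoVolumeDefect

set_option linter.dupNamespace false -- summit = problem name (single-conjunct summit), D-0017

open Real Finset
open Summit.HubbardSuperconductivity.HubbardSuperconductivity.Theorems.EngineV8

/-! ## §1 The source step in closed form from Chernoff data (T2-gen with a free first-order slot) -/

/-- **The source step in closed form from Chernoff data.**  For `0 ≤ μ`, a Chernoff parameter `w ≥ 1`, bounds `Σ_{δ∈[1,D]} τ^δ μ(δ) w^{δ−1} ≤ G`,
`towerV D τ μ ≤ V̄` with `ΦG < 1`, `ΦV̄ < 1`, and the suppliers' step hypothesis with an ARBITRARY first-order slot `FO`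
(`∀ N ≥ 2`, under the guard `ΦV < 1`: `src ≤ FO + Σ_{n∈[2,N]} e Φ^{n−1} ψ^p towerS_n(p) + ψ^p e V (ΦV)^N/(1−ΦV)`):
`src ≤ FO + e ψ^p (w^{p−1})⁻¹ G · ΦG/(1−ΦG)`.  (E1's `towerStep_le_of_chernoff` applied to `src − FO + towerFO D 0 μ p`.) -/
theorem srcStep_le_of_chernoff {D : ℕ} {μ : ℕ → ℝ} {src FO Φ ψ τ w G Vb : ℝ}
    (hΦ : 0 ≤ Φ) (hψ : 0 ≤ ψ) (hτ : 0 ≤ τ) (hμ0 : ∀ m, 0 ≤ μ m) (hw : 1 ≤ w) {p : ℕ}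
    (hG : ∑ δ ∈ Icc 1 D, τ ^ δ * μ δ * w ^ (δ - 1) ≤ G) (hVb : towerV D τ μ ≤ Vb) (hyG : Φ * G < 1) (hθ : Φ * Vb < 1)
    (hstep : ∀ N : ℕ, 2 ≤ N → Φ * towerV D τ μ < 1 →
      src ≤ FO + ∑ n ∈ Icc 2 N, exp 1 * Φ ^ (n - 1) * ψ ^ p * towerS D τ μ n p +
        ψ ^ p * exp 1 * towerV D τ μ * (Φ * towerV D τ μ) ^ N / (1 - Φ * towerV D τ μ)) :
    src ≤ FO + exp 1 * ψ ^ p * (w ^ (p - 1))⁻¹ * G * (Φ * G / (1 - Φ * G)) := by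
  have h := towerStep_le_of_chernoff (D := D) (μ := μ) (b := src - FO + towerFO D 0 μ p) (σ := 0) (F := towerFO D 0 μ p)
    hΦ hψ hτ hμ0 hw (p := p) le_rfl hG hVb hyG hθ (fun N hN hguard => by linarith [hstep N hN hguard])
  linarith

/-! ## §2 The four-piece reading -/

/-- **The source step on E1's four-piece profile.**  With `μ 1 ≤ ι₁λ`, `μ 2 ≤ ι₂λ`, `μ 3 ≤ ι₃λ²`, `μ m ≤ A'λ^{m−1}Q'^m` (`4 ≤ m ≤ D`),
`x₃ = eτλQ' < 1`, `Y := ι₁λ + ι₂/(2Q') + ι₃/(4Q'²) + A'Q'/4`, `y := Φ·τY < 1` and the four-piece field-norm guard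
`Φ·(eτι₁λ + (eτ)²ι₂λ + (eτ)³ι₃λ² + A'eτQ'x₃³/(1−x₃)) < 1`, the step hypothesis with a free first-order slot gives
`src ≤ FO + λ^{p−1} · (e ψτY (2τψQ')^{p−1}) · y/(1−y)` (`1 ≤ p`). -/
theorem srcStep_le_fourPiece {D : ℕ} {μ : ℕ → ℝ} {src FO Φ ψ τ lam Q' A' ι₁ ι₂ ι₃ : ℝ}
    (hΦ : 0 ≤ Φ) (hψ : 0 ≤ ψ) (hτ : 0 < τ) (hlam : 0 < lam) (hQ' : 0 < Q') (hA' : 0 ≤ A') (hμ0 : ∀ m, 0 ≤ μ m)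
    (hι₁ : μ 1 ≤ ι₁ * lam) (hι₂ : μ 2 ≤ ι₂ * lam) (hι₃ : μ 3 ≤ ι₃ * lam ^ 2)
    (hprof : ∀ m, 4 ≤ m → m ≤ D → μ m ≤ A' * lam ^ (m - 1) * Q' ^ m)
    (hx₂ : 2 * lam * τ * Q' ≤ 1) (hx₃ : exp 1 * τ * lam * Q' < 1)
    (hy : Φ * (τ * (ι₁ * lam + ι₂ / (2 * Q') + ι₃ / (4 * Q' ^ 2) + A' * Q' / 4)) < 1)
    (hθ : Φ * (exp 1 * τ * (ι₁ * lam) + (exp 1 * τ) ^ 2 * (ι₂ * lam) + (exp 1 * τ) ^ 3 * (ι₃ * lam ^ 2) +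
      A' * (exp 1 * τ * Q') * ((exp 1 * τ * lam * Q') ^ 3 / (1 - exp 1 * τ * lam * Q'))) < 1)
    {p : ℕ} (hp : 1 ≤ p)
    (hstep : ∀ N : ℕ, 2 ≤ N → Φ * towerV D τ μ < 1 →
      src ≤ FO + ∑ n ∈ Icc 2 N, exp 1 * Φ ^ (n - 1) * ψ ^ p * towerS D τ μ n p +
        ψ ^ p * exp 1 * towerV D τ μ * (Φ * towerV D τ μ) ^ N / (1 - Φ * towerV D τ μ)) :
    src ≤ FO + lam ^ (p - 1) * (exp 1 * (ψ * τ) * (ι₁ * lam + ι₂ / (2 * Q') + ι₃ / (4 * Q' ^ 2) + A' * Q' / 4) *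
      (2 * τ * ψ * Q') ^ (p - 1)) *
      (Φ * (τ * (ι₁ * lam + ι₂ / (2 * Q') + ι₃ / (4 * Q' ^ 2) + A' * Q' / 4)) /
        (1 - Φ * (τ * (ι₁ * lam + ι₂ / (2 * Q') + ι₃ / (4 * Q' ^ 2) + A' * Q' / 4)))) := by
  set Y : ℝ := ι₁ * lam + ι₂ / (2 * Q') + ι₃ / (4 * Q' ^ 2) + A' * Q' / 4 with hY
  have hw : 1 ≤ (2 * τ * Q' * lam)⁻¹ := (one_le_inv₀ (by positivity)).2 (by linarith)
  have hG := sum_fourPiece_le (D := D) hτ hlam hQ' hA' hμ0 hι₁ hι₂ hι₃ hprof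
  have hVb := towerV_le_fourPiece (D := D) hτ.le hlam.le hQ'.le hA' hμ0 hι₁ hι₂ hι₃ hprof hx₃
  have h := srcStep_le_of_chernoff (D := D) hΦ hψ hτ.le hμ0 hw (p := p) hG hVb hy hθ hstep
  -- `(w^{p−1})⁻¹ = (2τQ'λ)^{p−1}` and the regrouping `ψ^p (2τQ'λ)^{p−1} τ = λ^{p−1} ψτ (2τψQ')^{p−1}`
  have hwpow : (((2 * τ * Q' * lam)⁻¹) ^ (p - 1))⁻¹ = (2 * τ * Q' * lam) ^ (p - 1) := by rw [inv_pow, inv_inv]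
  rw [hwpow] at h
  refine h.trans (le_of_eq ?_)
  obtain ⟨q, rfl⟩ : ∃ q, p = q + 1 := ⟨p - 1, by omega⟩
  simp only [Nat.add_sub_cancel]
  rw [← hY]
  have : exp 1 * ψ ^ (q + 1) * (2 * τ * Q' * lam) ^ q * (τ * Y) = lam ^ q * (exp 1 * (ψ * τ) * Y * (2 * τ * ψ * Q') ^ q) := by
    rw [pow_succ, mul_pow, mul_pow, mul_pow, mul_pow, mul_pow, mul_pow]
    ring
  rw [this]

/-! ## §3 The entry-cost first order in closed form -/

/-- `(p+1)(2p+1) ≤ 2·4^p`. -/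
theorem two_mul_four_pow_ge (p : ℕ) : ((p + 1) * (2 * p + 1) : ℕ) ≤ 2 * 4 ^ p := by
  induction p with
  | zero => norm_num
  | succ p ih =>
    have h4 : 1 ≤ 4 ^ p := Nat.one_le_pow _ _ (by norm_num)
    have : (p + 1 + 1) * (2 * (p + 1) + 1) = (p + 1) * (2 * p + 1) + (4 * p + 5) := by ring
    rw [this, pow_succ]
    nlinarith

/-- `1 + 4^{p+1}·x/(1−x) ≤ 4^{p+1}/(1−x)` for `0 ≤ x < 1`. -/
theorem one_add_pow_mul_div_le {x : ℝ} (hx0 : 0 ≤ x) (hx1 : x < 1) (p : ℕ) :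
    1 + (4 : ℝ) ^ (p + 1) * (x / (1 - x)) ≤ (4 : ℝ) ^ (p + 1) / (1 - x) := by
  have h1 : 0 < 1 - x := sub_pos.2 hx1
  have hne : 1 - x ≠ 0 := h1.ne'
  have h4 : (1 : ℝ) ≤ 4 ^ (p + 1) := one_le_pow₀ (by norm_num)
  have heq : 1 + (4 : ℝ) ^ (p + 1) * (x / (1 - x)) = ((1 - x) + 4 ^ (p + 1) * x) / (1 - x) := by
    field_simp
  rw [heq]
  exact div_le_div_of_nonneg_right (by nlinarith) h1.le

/-- **The entry-cost first order of the near source in closed form.**  For the geometric profile `μ m ≤ A'λ^{m−1}Q'^m` on `4 ≤ m ≤ D+1`,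
`x₁ = 4σₙλQ' < 1`, `0 ≤ σₑ`, and `3 ≤ p ≤ D`:
`(p+1)(2p+1)·σₑ·[μ(p+1) + towerFO D σₙ μ (p+1)] ≤ (8σₑA'λQ'/(1−x₁)) · λ^{p−1} · (16Q')^p`
(`μ(p+1) ≤ A'λ^pQ'^{p+1}`, E1's `towerFO_le_of_four_le` at `p+1`, `1 + 4^{p+1}x₁/(1−x₁) ≤ 4^{p+1}/(1−x₁)`, `(p+1)(2p+1) ≤ 2·4^p`). -/
theorem foSrc_le {D : ℕ} {μ : ℕ → ℝ} {σe σn A' lam Q' : ℝ} (hσe : 0 ≤ σe) (hσn : 0 ≤ σn) (hA' : 0 ≤ A') (hlam : 0 ≤ lam) (hQ' : 0 ≤ Q')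
    (hμ0 : ∀ m, 0 ≤ μ m) (hprof : ∀ m, 4 ≤ m → m ≤ D + 1 → μ m ≤ A' * lam ^ (m - 1) * Q' ^ m)
    (hx₁ : 4 * σn * lam * Q' < 1) {p : ℕ} (hp : 3 ≤ p) (hpD : p ≤ D) :
    (((p + 1) * (2 * p + 1) : ℕ) : ℝ) * σe * (μ (p + 1) + towerFO D σn μ (p + 1)) ≤
      8 * σe * A' * lam * Q' / (1 - 4 * σn * lam * Q') * lam ^ (p - 1) * (16 * Q') ^ p := by
  have hx0 : 0 ≤ 4 * σn * lam * Q' := by positivity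
  have h1x : 0 < 1 - 4 * σn * lam * Q' := sub_pos.2 hx₁
  -- the identity term `μ(p+1)` and E1's first order at `p+1`
  have hμp : μ (p + 1) ≤ A' * lam ^ p * Q' ^ (p + 1) := by
    have h := hprof (p + 1) (by omega) (by omega)
    simpa only [Nat.add_sub_cancel] using h
  have hFO : towerFO D σn μ (p + 1) ≤ A' * lam ^ p * (4 * Q') ^ (p + 1) * (4 * σn * lam * Q' / (1 - 4 * σn * lam * Q')) := by
    have h := towerFO_le_of_four_le (D := D) hσn hA' hlam hQ' hμ0 (fun m hm hmD => hprof m hm (by omega)) hx₁ (p := p + 1) (by omega)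
    simpa only [Nat.add_sub_cancel] using h
  have hsum : μ (p + 1) + towerFO D σn μ (p + 1) ≤ A' * lam ^ p * Q' ^ (p + 1) * ((4 : ℝ) ^ (p + 1) / (1 - 4 * σn * lam * Q')) := by
    calc μ (p + 1) + towerFO D σn μ (p + 1)
        ≤ A' * lam ^ p * Q' ^ (p + 1) + A' * lam ^ p * (4 * Q') ^ (p + 1) * (4 * σn * lam * Q' / (1 - 4 * σn * lam * Q')) :=
          add_le_add hμp hFO
      _ = A' * lam ^ p * Q' ^ (p + 1) * (1 + (4 : ℝ) ^ (p + 1) * (4 * σn * lam * Q' / (1 - 4 * σn * lam * Q'))) := by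
          rw [mul_pow]; ring
      _ ≤ A' * lam ^ p * Q' ^ (p + 1) * ((4 : ℝ) ^ (p + 1) / (1 - 4 * σn * lam * Q')) :=
          mul_le_mul_of_nonneg_left (one_add_pow_mul_div_le hx0 hx₁ p) (by positivity)
  have hcomb : (((p + 1) * (2 * p + 1) : ℕ) : ℝ) ≤ 2 * (4 : ℝ) ^ p := by exact_mod_cast two_mul_four_pow_ge p
  calc (((p + 1) * (2 * p + 1) : ℕ) : ℝ) * σe * (μ (p + 1) + towerFO D σn μ (p + 1))
      ≤ (2 * (4 : ℝ) ^ p) * σe * (A' * lam ^ p * Q' ^ (p + 1) * ((4 : ℝ) ^ (p + 1) / (1 - 4 * σn * lam * Q'))) := by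
        have h0 : 0 ≤ μ (p + 1) + towerFO D σn μ (p + 1) := add_nonneg (hμ0 _) (towerFO_nonneg hσn hμ0 _)
        gcongr
    _ = 8 * σe * A' * lam * Q' / (1 - 4 * σn * lam * Q') * lam ^ (p - 1) * (16 * Q') ^ p := by
        obtain ⟨q, rfl⟩ : ∃ q, p = q + 1 := ⟨p - 1, by omega⟩
        simp only [Nat.add_sub_cancel, pow_succ, mul_pow]
        have h16 : (16 : ℝ) ^ q = 4 ^ q * 4 ^ q := by rw [← mul_pow]; norm_num
        rw [h16]
        field_simp
        ring

/-! ## §4 The `hsrc` law row of T3-Lip₄ -/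

/-- **THE NEAR COVARIANCE SOURCE IS LAW-SHAPED WITH A SMALL PREFACTOR** (the `hsrc` row of `towerBornDiff_le_law₄`).  Under the hypotheses of
`srcStep_le_fourPiece` (four-piece majorant of the block's law-unit data, guards `y < 1`, `θ̄ < 1`, `x₂`, `x₃`) and of `foSrc_le` (`x₁ < 1`, profile
up to `D+1`), with the step hypothesis whose first-order slot is the entry-cost term `(p+1)(2p+1)σₑ[μ(p+1) + towerFO D σₙ μ (p+1)]`, and the scale
separations `16Q' ≤ Q`, `2τψQ' ≤ Q` of the final law constant `Q` (`0 < A`):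
**`src ≤ s · (A λ^{p−1} Q^p)`**, `s = (8σₑA'λQ'/(1−x₁) + eψτY·(y/(1−y))/Q)/A` — linear in the entry number `σₑ` and in `y = ΦτY ∝ Φ` (the weighted
rows) of the defect covariance, uniformly in `3 ≤ p ≤ D`. -/
theorem src_le_law {D : ℕ} {μ : ℕ → ℝ} {src σe σn Φ ψ τ lam Q' A' ι₁ ι₂ ι₃ A Q : ℝ}
    (hσe : 0 ≤ σe) (hσn : 0 ≤ σn) (hΦ : 0 ≤ Φ) (hψ : 0 ≤ ψ) (hτ : 0 < τ) (hlam : 0 < lam) (hQ' : 0 < Q') (hA' : 0 ≤ A')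
    (hA : 0 < A) (hμ0 : ∀ m, 0 ≤ μ m)
    (hι₁ : μ 1 ≤ ι₁ * lam) (hι₂ : μ 2 ≤ ι₂ * lam) (hι₃ : μ 3 ≤ ι₃ * lam ^ 2)
    (hprof : ∀ m, 4 ≤ m → m ≤ D + 1 → μ m ≤ A' * lam ^ (m - 1) * Q' ^ m)
    (hx₁ : 4 * σn * lam * Q' < 1) (hx₂ : 2 * lam * τ * Q' ≤ 1) (hx₃ : exp 1 * τ * lam * Q' < 1)
    (hy : Φ * (τ * (ι₁ * lam + ι₂ / (2 * Q') + ι₃ / (4 * Q' ^ 2) + A' * Q' / 4)) < 1)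
    (hθ : Φ * (exp 1 * τ * (ι₁ * lam) + (exp 1 * τ) ^ 2 * (ι₂ * lam) + (exp 1 * τ) ^ 3 * (ι₃ * lam ^ 2) +
      A' * (exp 1 * τ * Q') * ((exp 1 * τ * lam * Q') ^ 3 / (1 - exp 1 * τ * lam * Q'))) < 1)
    (hu₁ : 16 * Q' ≤ Q) (hu₂ : 2 * τ * ψ * Q' ≤ Q)
    {p : ℕ} (hp : 3 ≤ p) (hpD : p ≤ D)
    (hstep : ∀ N : ℕ, 2 ≤ N → Φ * towerV D τ μ < 1 →
      src ≤ (((p + 1) * (2 * p + 1) : ℕ) : ℝ) * σe * (μ (p + 1) + towerFO D σn μ (p + 1)) +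
        ∑ n ∈ Icc 2 N, exp 1 * Φ ^ (n - 1) * ψ ^ p * towerS D τ μ n p +
        ψ ^ p * exp 1 * towerV D τ μ * (Φ * towerV D τ μ) ^ N / (1 - Φ * towerV D τ μ)) :
    src ≤ ((8 * σe * A' * lam * Q' / (1 - 4 * σn * lam * Q') +
        exp 1 * (ψ * τ) * (ι₁ * lam + ι₂ / (2 * Q') + ι₃ / (4 * Q' ^ 2) + A' * Q' / 4) *
          (Φ * (τ * (ι₁ * lam + ι₂ / (2 * Q') + ι₃ / (4 * Q' ^ 2) + A' * Q' / 4)) /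
            (1 - Φ * (τ * (ι₁ * lam + ι₂ / (2 * Q') + ι₃ / (4 * Q' ^ 2) + A' * Q' / 4)))) / Q) / A) *
      (A * lam ^ (p - 1) * Q ^ p) := by
  set Y : ℝ := ι₁ * lam + ι₂ / (2 * Q') + ι₃ / (4 * Q' ^ 2) + A' * Q' / 4 with hY
  set z : ℝ := Φ * (τ * Y) / (1 - Φ * (τ * Y)) with hz
  have hQ : 0 < Q := lt_of_lt_of_le (by positivity) hu₁
  have hx0 : 0 ≤ 4 * σn * lam * Q' := by positivity
  have h1x : 0 < 1 - 4 * σn * lam * Q' := sub_pos.2 hx₁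
  -- `Y ≥ 0` (from `0 ≤ μ`), hence `z ≥ 0`
  have hι₁0 : 0 ≤ ι₁ * lam := (hμ0 1).trans hι₁
  have hι₂0 : 0 ≤ ι₂ := by
    by_contra h
    exact absurd ((hμ0 2).trans hι₂) (not_le.2 (mul_neg_of_neg_of_pos (not_le.1 h) hlam))
  have hι₃0 : 0 ≤ ι₃ := by
    by_contra h
    exact absurd ((hμ0 3).trans hι₃) (not_le.2 (mul_neg_of_neg_of_pos (not_le.1 h) (by positivity)))
  have hY0 : 0 ≤ Y := by rw [hY]; positivity
  have hz0 : 0 ≤ z := div_nonneg (by positivity) (sub_nonneg.2 hy.le)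
  -- §2 + §3
  have hgr := srcStep_le_fourPiece (D := D) hΦ hψ hτ hlam hQ' hA' hμ0 hι₁ hι₂ hι₃ (fun m hm hmD => hprof m hm (by omega)) hx₂ hx₃ hy hθ
    (p := p) (by omega) hstep
  have hfo := foSrc_le (D := D) hσe hσn hA' hlam.le hQ'.le hμ0 hprof hx₁ hp hpD
  -- the two scale separations: `(16Q')^p ≤ Q^p`, `(2τψQ')^{p−1} ≤ Q^{p−1} ≤ Q^p/Q`
  have h16 : (16 * Q') ^ p ≤ Q ^ p := pow_le_pow_left₀ (by positivity) hu₁ p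
  have h2τ : (2 * τ * ψ * Q') ^ (p - 1) ≤ Q ^ p / Q := by
    have h := pow_le_pow_left₀ (by positivity) hu₂ (p - 1)
    refine h.trans (le_of_eq ?_)
    obtain ⟨q, rfl⟩ : ∃ q, p = q + 1 := ⟨p - 1, by omega⟩
    rw [Nat.add_sub_cancel, pow_succ, mul_div_assoc, div_self hQ.ne', mul_one]
  have hlam0 : 0 ≤ lam ^ (p - 1) := pow_nonneg hlam.le _
  calc src ≤ (((p + 1) * (2 * p + 1) : ℕ) : ℝ) * σe * (μ (p + 1) + towerFO D σn μ (p + 1)) +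
        lam ^ (p - 1) * (exp 1 * (ψ * τ) * Y * (2 * τ * ψ * Q') ^ (p - 1)) * z := hgr
    _ ≤ 8 * σe * A' * lam * Q' / (1 - 4 * σn * lam * Q') * lam ^ (p - 1) * (16 * Q') ^ p +
        lam ^ (p - 1) * (exp 1 * (ψ * τ) * Y * (2 * τ * ψ * Q') ^ (p - 1)) * z := add_le_add hfo le_rfl
    _ ≤ 8 * σe * A' * lam * Q' / (1 - 4 * σn * lam * Q') * lam ^ (p - 1) * Q ^ p +
        lam ^ (p - 1) * (exp 1 * (ψ * τ) * Y * (Q ^ p / Q)) * z := by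
        gcongr
    _ = ((8 * σe * A' * lam * Q' / (1 - 4 * σn * lam * Q') + exp 1 * (ψ * τ) * Y * z / Q) / A) * (A * lam ^ (p - 1) * Q ^ p) := by
        field_simp

end Summit.HubbardSuperconductivity.HubbardSuperconductivity.Theorems.TwoVolumeDefect

end
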